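import Summits.CriticalPhenomena.PercolationContinuityZ3.Theorems.Transplant.SiteTwoMaxArea
import Mathlib.GroupTheory.SemidirectProduct
import Mathlib.Algebra.Group.Units.Equiv
import HarnessLib

/-!
# The split planar crystallographic groups `p4 = ℤ² ⋊ C₄` and `p2 = ℤ² ⋊ C₂` — DEFINITIONS (the quarter turn of `ℤ²`; the groups as semidirect products over the
# cyclic subgroups of `Aut(ℤ²)` generated by the quarter turn / the inversion)

builds on p205010 (kernel theorem, internal audit signed; external expert review pending) — nothing in this file uses p205010; nothing here is a claim about any
open node.  Lane `prim-bschramm`, seat `prim-bschramm-p4` gen 28 (PART C3 of `P4-GENERAL.md` §50.11: instances of the twist criterion `AutEndStateTypesTwist`).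
Helper file (`--supports stmt-CriticalPhenomena-4575 --as helper`).  DEFINITIONS + `simp` API only; the theorems are in `AutEndStateTypesPlanar`.

* `Planar.L = Multiplicative (Site 2)` — the lattice `ℤ²` written multiplicatively; `Planar.rot4 : MulAut L` — the quarter turn `(x, y) ↦ (−y, x)`;
* `Planar.Grp4 = ℤ² ⋊ ⟨rot4⟩` (the wallpaper group `p4`, split), `Planar.Grp2 = ℤ² ⋊ ⟨inversion⟩` (the wallpaper group `p2`), both as Mathlib `SemidirectProduct`s over
  the cyclic subgroups `zpowers rot4`, `zpowers (MulEquiv.inv L)` of `Aut(ℤ²)` acting through the inclusion.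
[cite: BenjaminiSchramm1996, §2 (Cayley graphs; almost transitive graphs)] [cite: KozmaNitzan2024, §4 p. 16 (Lemma 8: the role of the lattice symmetries)]
-/

noncomputable section

namespace Summit.CriticalPhenomena.PercolationContinuityZ3.Theorems.Transplant

open Literature.Probability.LatticeModels

namespace Planar

/-- The lattice `ℤ²`, written multiplicatively. [folklore] -/
abbrev L : Type := Multiplicative (Site 2)

/-- **The quarter turn** `(x, y) ↦ (−y, x)` of `ℤ²`, as a multiplicative automorphism. [folklore] -/
def rot4 : MulAut L where
  toFun v := Multiplicative.ofAdd ![-(Multiplicative.toAdd v 1), Multiplicative.toAdd v 0]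
  invFun v := Multiplicative.ofAdd ![Multiplicative.toAdd v 1, -(Multiplicative.toAdd v 0)]
  left_inv v := Multiplicative.toAdd.injective (funext fun i => by
    fin_cases i <;> simp only [toAdd_ofAdd, Fin.zero_eta, Fin.isValue, Fin.mk_one, Matrix.cons_val_zero, Matrix.cons_val_one, Matrix.cons_val_fin_one, neg_neg])
  right_inv v := Multiplicative.toAdd.injective (funext fun i => by
    fin_cases i <;> simp only [toAdd_ofAdd, Fin.zero_eta, Fin.isValue, Fin.mk_one, Matrix.cons_val_zero, Matrix.cons_val_one, Matrix.cons_val_fin_one, neg_neg])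
  map_mul' v w := Multiplicative.toAdd.injective (funext fun i => by
    fin_cases i <;> simp only [toAdd_ofAdd, toAdd_mul, Pi.add_apply, Fin.zero_eta, Fin.isValue, Fin.mk_one, Matrix.cons_val_zero, Matrix.cons_val_one,
      Matrix.cons_val_fin_one, neg_add])

/-- The quarter turn on the first coordinate: `(rot4 v)₀ = −v₁`. [folklore] -/
@[simp] theorem toAdd_rot4_zero (v : L) : Multiplicative.toAdd (rot4 v) 0 = -(Multiplicative.toAdd v 1) := rfl

/-- The quarter turn on the second coordinate: `(rot4 v)₁ = v₀`. [folklore] -/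
@[simp] theorem toAdd_rot4_one (v : L) : Multiplicative.toAdd (rot4 v) 1 = Multiplicative.toAdd v 0 := rfl

/-- **`p4 = ℤ² ⋊ C₄`**: the lattice extended by the cyclic group generated by the quarter turn, acting through the inclusion into `Aut(ℤ²)`.
[cite: KozmaNitzan2024, §4 p. 16 (Lemma 8)] -/
abbrev Grp4 : Type := L ⋊[(Subgroup.zpowers rot4).subtype] (Subgroup.zpowers rot4)

/-- **`p2 = ℤ² ⋊ C₂`**: the lattice extended by the central inversion `v ↦ v⁻¹` (the generalised dihedral group of `ℤ²`).
[cite: KozmaNitzan2024, §4 p. 16 (Lemma 8)] -/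
abbrev Grp2 : Type := L ⋊[(Subgroup.zpowers (MulEquiv.inv L)).subtype] (Subgroup.zpowers (MulEquiv.inv L))

end Planar

end Summit.CriticalPhenomena.PercolationContinuityZ3.Theorems.Transplant

end
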